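/-
Copyright (c) 2026. All rights reserved.
Released under Apache 2.0 license as described in the file LICENSE.
Authors: abc-iut cell, discharge seat abc-iut-w4-d020 (gen 8) ([AbsTopIII] Prop 5.8 (i): the images
`Im(𝒪_k^▷ ↪ G^ab)`, `Im(k^× ↪ G^ab)` of abc-iut-L6-d2's `MonoAnalyticNonarchAlgorithm.model` are
PRESENTATION-INDEPENDENT; proof-only companion over `MonoAnalyticNonarchAlgorithmModel.lean`).
-/
import Literature.AnabelianGeometry.AbsoluteAnabelian.MonoAnalyticNonarchAlgorithmModel
import Literature.AnabelianGeometry.AbsoluteAnabelian.MLFUnitImageReductionProofs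
import Literature.AnabelianGeometry.AbsoluteAnabelian.MLFGaloisGroupsHolds
import Literature.AnabelianGeometry.AbsoluteAnabelian.AbsAnabLevelTransportProofs
import Literature.NumberTheory.GaloisRepresentations.LocalReciprocityThetaProofs
import Literature.NumberTheory.GaloisRepresentations.LocalFieldCdTwo
import HarnessLib

/-!
# [AbsTopIII] Prop 5.8 (i): the images `Im(𝒪_k^▷)`, `Im(k^×)` in `G^ab` are group-theoretic (canonical)

S. Mochizuki, *Topics in absolute anabelian geometry III* [MochizukiAbsTopIII2015], Prop 5.8 (i),
manuscript p. 139 l. 27–33: "there exists a functorial [i.e., relative to `TG⊢`] 'group-theoretic'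
algorithm for constructing the images of the embeddings `𝒪_k^▷ ↪ G_k^ab`, `k^× ↪ G_k^ab` of local class
field theory [cf. [AbsAnab], Proposition 1.2.1, (iii), (iv)]."  abc-iut-L4-t3 typed these outputs as the
fields `integralImage`, `multImage` of `MonoAnalyticNonarch G`; abc-iut-L6-d2 INHABITED the algorithm
(`MonoAnalyticNonarchAlgorithm.model`): at `G` of MLF-Galois type it is the genuine model at a CHOSEN
presentation `G ≅ G_E` (`E ⊆ ℚ̄_p` finite), transported along the chosen isomorphism, with the images of
a CHOSEN reciprocity map of `E`.  This PROOF-ONLY file removes both choices from the (i)-outputs: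

* `IsLocalReciprocityMap.image_integers_eq_frobPow`: for ANY reciprocity map `θ` of a non-archimedean
  local field `K` (the tree's `IsLocalReciprocityMap`), `θ(𝒪_K^▷) = {[σ] : σ ∈ G_K, IsFrobPow σ n, n ∈ ℕ}`
  (classes of NON-NEGATIVE FROBENIUS POWERS) — a description inside `G_K ↷ 𝒪_{K̄}/𝔓`, independent of `θ`;
* `map_absInertia_eq_of_continuousMulEquiv`, `isFrobPow_map_natCast_of_continuousMulEquiv`,
  `map_weilSubgroup_eq_of_continuousMulEquiv`: an isomorphism `G_{K₁} ≃ₜ* G_{K₂}` preserves inertia,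
  non-negative Frobenius powers with their exponents, and Weil groups ([AbsAnab] Prop 1.2.1 (ii)–(iv),
  PROVED in the tree: `galoisMLF_iso_unitImage_holds`, `isFrobPow_one_map_of_continuousMulEquiv`);
* `MonoAnalyticNonarchAlgorithm.mem_model_out_integralImage_iff` / `mem_model_out_multImage_iff`: for
  EVERY presentation `P : G ≅ G_E` (not only the chosen one) membership in the reconstructed `Im(𝒪^▷)`,
  `Im(k^×)` of `model.out G` is read off in `G_E` (non-negative Frobenius powers, resp. the Weil group):
  the (i)-outputs are invariants of the topological group `G` — PRESENTATION-INDEPENDENT;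
* `…_iff_of_iso`, `model_out_images_comap_of_iso`: "functorial" for ISOMORPHISMS of `Ob(TG⊢)` — the
  induced `G^ab ⥲ H^ab` identifies the (i)-images of `model.out G` and `model.out H`.

HONEST FRAMING: classical, refereed ([AbsAnab], [AbsTopIII]); OUR kernel check that the typed (i)-outputs
of the inhabited interface are canonical.  Print's contravariant functoriality along arbitrary OPEN
INJECTIONS (Verlagerung) is not a field of the typed interface and is not treated here.  No new
definition, no named-fact hypothesis; nothing here bears on [IUTchIII] Cor. 3.12; typed ≠ discharged.
-/

set_option autoImplicit false

noncomputable section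

namespace Literature.AnabelianGeometry.AbsoluteAnabelian

open Set ValuativeRel Field
open scoped ValuativeRel Pointwise
open Literature.NumberTheory.GaloisRepresentations
open Literature.NumberTheory.GaloisRepresentations.IsNonarchimedeanLocalField

/-! ## 1. Valued local fields: `θ(𝒪_K^▷)` is the set of classes of non-negative Frobenius powers -/

section Valued

variable {K : Type} [Field K] [ValuativeRel K] [TopologicalSpace K] [IsNonarchimedeanLocalField K]

/-- `φ^m` is a Frobenius power of exponent `m ∈ ℤ` if `φ` is one of exponent `1`. [cite: MochizukiAbsAnab2004, Prop 1.2.1 (iv) p.10] -/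
theorem isFrobPow_zpow {φ : absoluteGaloisGroup K} (hφ : IsFrobPow φ 1) (m : ℤ) :
    IsFrobPow (φ ^ m) m := by
  rcases Int.eq_nat_or_neg m with ⟨k, rfl | rfl⟩
  · rw [zpow_natCast]; exact isFrobPow_pow hφ k
  · rw [zpow_neg, zpow_natCast]; exact (isFrobPow_pow hφ k).inv

/-- `closure [G_K, G_K] ≤ I_K` (the maximal unramified extension is abelian over nothing smaller:
`K^{nr} ⊆ K^{ab}`), from the tree's density of the Weil group.
[cite: MochizukiAbsAnab2004, Prop 1.2.1 (iii) p.10] -/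
theorem topologicalClosure_commutator_le_absInertia :
    (commutator (absoluteGaloisGroup K)).topologicalClosure ≤ absInertia K :=
  WeilGroup.topologicalClosure_commutator_absGalois_le_absInertia
    (WeilGroup.denseRange_toAbsGalois_holds K)

/-- **`θ(𝒪_K^▷) =` the classes of the non-negative Frobenius powers**, for ANY local reciprocity map
`θ : K^× → G_K^ab` (`IsLocalReciprocityMap`: injective, `θ(K^×) = [W_K]`, `θ(𝒪_K^×) = [I_K]`, uniformisers
↦ arithmetic Frobenius classes): write `x = u·ϖⁿ` (`u` a unit, `n = v_K(x) ≥ 0`), so `θ(x) = [i·φⁿ]`,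
`i ∈ I_K`, `φ` an arithmetic Frobenius; conversely the exponent of a Frobenius power is unique.  Print's
"image of `𝒪_k^▷ ↪ G_k^ab`" described inside `G_k` alone. [cite: MochizukiAbsTopIII2015, Prop 5.8 (i) p. 139] -/
theorem _root_.Literature.NumberTheory.GaloisRepresentations.IsLocalReciprocityMap.image_integers_eq_frobPow
    {θ : Kˣ →* absoluteGaloisGroupAbelianization K} (hθ : IsLocalReciprocityMap K θ) :
    θ '' {x : Kˣ | valuation K (x : K) ≤ 1} =
      {a | ∃ σ : absoluteGaloisGroup K, (∃ n : ℕ, IsFrobPow σ n) ∧ absGaloisAbProj K σ = a} := by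
  classical
  -- a uniformiser `ϖ` and an arithmetic Frobenius `φ` with `θ ϖ = [φ]`
  obtain ⟨ϖ, hϖ⟩ := exists_units_isUniformizer (F := K)
  obtain ⟨φ, hφθ⟩ := QuotientGroup.mk_surjective (θ ϖ)
  have hφ : IsFrobPow φ 1 := hθ.isFrobPow_one_of_isUniformizer ϖ hϖ φ hφθ
  have hϖv : valuation K (ϖ : K) = unifValue K := hϖ
  -- every `x = u·ϖ^k` has `θ x = [i·φ^k]` with `i ∈ I_K`, and `v(x) = v(ϖ)^k`
  have key : ∀ x : Kˣ, ∃ (i : absoluteGaloisGroup K) (k : ℤ), i ∈ absInertia K ∧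
      θ x = absGaloisAbProj K (i * φ ^ k) ∧ valuation K (x : K) = unifValue K ^ k := by
    intro x
    obtain ⟨u, k, hu, rfl⟩ := exists_unitGroup_mul_zpow hϖ x
    have hθu : θ u ∈ ((valuation K).valuationSubring.unitGroup).map θ := ⟨u, hu, rfl⟩
    rw [hθ.map_unitGroup] at hθu
    obtain ⟨i, hi, hiu⟩ := hθu
    refine ⟨i, k, hi, ?_, ?_⟩
    · rw [map_mul, map_zpow, ← hiu, ← hφθ, map_mul, map_zpow]
      rfl
    · rw [Valuation.mem_unitGroup_iff] at hu
      rw [Units.val_mul, Units.val_zpow_eq_zpow_val, map_mul, map_zpow₀, hu, hϖv, one_mul]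
  ext a
  constructor
  · rintro ⟨x, hx, rfl⟩
    obtain ⟨i, k, hi, hθx, hvx⟩ := key x
    have hk : 0 ≤ k := by
      rw [mem_setOf_eq, hvx] at hx
      exact (zpow_le_one_iff_right_of_lt_one₀ (unifValue_pos K) (unifValue_lt_one K)).mp hx
    obtain ⟨n, rfl⟩ := Int.eq_ofNat_of_zero_le hk
    refine ⟨i * φ ^ (n : ℤ), ⟨n, ?_⟩, hθx.symm⟩
    have h := IsFrobPow.mul_holds (isFrobPow_zero_iff_mem_absInertia.mpr hi) (isFrobPow_zpow hφ n)
    rwa [zero_add] at h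
  · rintro ⟨σ, ⟨n, hσn⟩, rfl⟩
    -- `[σ] ∈ [W_K] = θ(K^×)`
    have hmem : absGaloisAbProj K σ ∈ (weilSubgroup K).map (absGaloisAbProj K) :=
      ⟨σ, mem_weilSubgroup_of_isFrobPow hσn, rfl⟩
    rw [← hθ.range_eq] at hmem
    obtain ⟨x, hx⟩ := hmem
    obtain ⟨i, k, hi, hθx, hvx⟩ := key x
    -- `[σ] = [i·φ^k]`, so `σ·c = i·φ^k` with `c` in the closure of the commutator, `⊆ I_K`
    have heq : absGaloisAbProj K σ = absGaloisAbProj K (i * φ ^ k) := by rw [← hθx, hx]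
    obtain ⟨c, hc, hσc⟩ := (QuotientGroup.mk'_eq_mk' _).mp heq
    have hcI : c ∈ absInertia K := topologicalClosure_commutator_le_absInertia hc
    have h1 : IsFrobPow (σ * c) ((n : ℤ) + 0) :=
      IsFrobPow.mul_holds hσn (isFrobPow_zero_iff_mem_absInertia.mpr hcI)
    have h2 : IsFrobPow (i * φ ^ k) (0 + k) :=
      IsFrobPow.mul_holds (isFrobPow_zero_iff_mem_absInertia.mpr hi) (isFrobPow_zpow hφ k)
    rw [hσc] at h1
    have hnk : (n : ℤ) + 0 = 0 + k := IsFrobPow.unique_holds h1 h2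
    have hk : 0 ≤ k := by omega
    refine ⟨x, ?_, hx⟩
    rw [mem_setOf_eq, hvx]
    exact (zpow_le_one_iff_right_of_lt_one₀ (unifValue_pos K) (unifValue_lt_one K)).mpr hk

end Valued

/-! ## 2. Isomorphisms of absolute Galois groups preserve inertia and non-negative Frobenius powers -/

section Iso

variable {K₁ : Type} [Field K₁] [ValuativeRel K₁] [TopologicalSpace K₁] [IsNonarchimedeanLocalField K₁]
  [CharZero K₁]
  {K₂ : Type} [Field K₂] [ValuativeRel K₂] [TopologicalSpace K₂] [IsNonarchimedeanLocalField K₂]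
  [CharZero K₂]

/-- [AbsAnab] Prop 1.2.1 (ii) in the valued model: `α(I_{K₁}) = I_{K₂}` (from the tree's PROVED
`galoisMLF_iso_unitImage_holds`, whose first clause is `α(I₁·C₁) = I₂·C₂`, and `Cᵢ ≤ Iᵢ`).
[cite: MochizukiAbsAnab2004, Prop 1.2.1 (ii) p.10] -/
theorem map_absInertia_eq_of_continuousMulEquiv (α : absoluteGaloisGroup K₁ ≃ₜ* absoluteGaloisGroup K₂) :
    (absInertia K₁).map α.toMulEquiv.toMonoidHom = absInertia K₂ := by
  have h := (galoisMLF_iso_unitImage_holds K₁ K₂ α).1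
  rwa [sup_eq_left.mpr (topologicalClosure_commutator_le_absInertia (K := K₁)),
    sup_eq_left.mpr (topologicalClosure_commutator_le_absInertia (K := K₂))] at h

/-- **`α` preserves non-negative Frobenius powers with their exponents**: `IsFrobPow σ n ⇒
IsFrobPow (α σ) n` for `n ∈ ℕ` (`σ = i·φⁿ` with `i ∈ I_{K₁}`, `φ` an arithmetic Frobenius; apply
(ii) to `i` and (iv) to `φ`). [cite: MochizukiAbsAnab2004, Prop 1.2.1 (iv) p.10] -/
theorem isFrobPow_map_natCast_of_continuousMulEquiv (α : absoluteGaloisGroup K₁ ≃ₜ* absoluteGaloisGroup K₂)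
    {σ : absoluteGaloisGroup K₁} {n : ℕ} (hσ : IsFrobPow σ n) : IsFrobPow (α σ) n := by
  obtain ⟨φ, hφ⟩ := exists_isFrobPow_holds K₁ 1
  -- `i := σ·(φⁿ)⁻¹ ∈ I_{K₁}`
  have hi : σ * (φ ^ n)⁻¹ ∈ absInertia K₁ := by
    rw [← isFrobPow_zero_iff_mem_absInertia]
    have h := IsFrobPow.mul_holds hσ (isFrobPow_pow hφ n).inv
    rwa [add_neg_cancel] at h
  have hαi : α (σ * (φ ^ n)⁻¹) ∈ absInertia K₂ := by
    rw [← map_absInertia_eq_of_continuousMulEquiv α]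
    exact ⟨_, hi, rfl⟩
  have hαφ : IsFrobPow (α φ ^ n) (n : ℤ) := isFrobPow_pow (isFrobPow_one_map_of_continuousMulEquiv α hφ) n
  have h := IsFrobPow.mul_holds (isFrobPow_zero_iff_mem_absInertia.mpr hαi) hαφ
  rw [zero_add, ← map_pow, ← map_mul, inv_mul_cancel_right] at h
  exact h

/-- `α` carries the Weil group onto the Weil group (classes of ALL Frobenius powers): from the tree's
PROVED `galoisMLF_iso_unitImage_holds`, second clause `α(W₁·C₁) = W₂·C₂`, and `Cᵢ ≤ Iᵢ ≤ Wᵢ`.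
[cite: MochizukiAbsAnab2004, Prop 1.2.1 (iii) p.10] -/
theorem map_weilSubgroup_eq_of_continuousMulEquiv (α : absoluteGaloisGroup K₁ ≃ₜ* absoluteGaloisGroup K₂) :
    (weilSubgroup K₁).map α.toMulEquiv.toMonoidHom = weilSubgroup K₂ := by
  have h := (galoisMLF_iso_unitImage_holds K₁ K₂ α).2
  rwa [sup_eq_left.mpr ((topologicalClosure_commutator_le_absInertia (K := K₁)).trans
      (absInertia_le_weilSubgroup K₁)),
    sup_eq_left.mpr ((topologicalClosure_commutator_le_absInertia (K := K₂)).trans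
      (absInertia_le_weilSubgroup K₂))] at h

end Iso

/-! ## 3. The model `G ↦ MonoAnalyticNonarch G`: the (i)-images are presentation-independent -/

section Transport

variable {G H : ProfiniteGrp.{0}}

/-- Induced maps on profinite abelianizations compose: `(e ≫ f)^ab = f^ab ∘ e^ab`. [cite: MochizukiAbsTopIII2015, Prop 5.8 (i) p. 139] -/
theorem profiniteAbelianizationCongr_trans_apply {L : ProfiniteGrp.{0}} (e : G ≃ₜ* H) (f : H ≃ₜ* L)
    (a : profiniteAbelianization G) :
    profiniteAbelianizationCongr (e.trans f) a =
      profiniteAbelianizationCongr f (profiniteAbelianizationCongr e a) := by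
  induction a using QuotientGroup.induction_on with | H g => rfl

end Transport

section Subfield

variable {p : ℕ} [Fact p.Prime] (E : IntermediateField ℚ_[p] (PadicAlgCl p)) [FiniteDimensional ℚ_[p] E]

omit [FiniteDimensional ℚ_[p] E] in
/-- `𝒪_E^▷` (the model's `‖x‖ ≤ 1`) is `{x : v(x) ≤ 1}` for the valuative structure of `E ⊆ ℚ̄_p`.
[cite: MochizukiAbsTopIII2015, Prop 5.8 (i) p. 139] -/
theorem PadicAlgCl.coe_subfieldIntegralUnits :
    letI := PadicAlgCl.subfieldValuativeRel E
    ((PadicAlgCl.subfieldIntegralUnits E : Submonoid Eˣ) : Set Eˣ) =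
      {x : Eˣ | valuation E (x : E) ≤ 1} := by
  letI := PadicAlgCl.subfieldValuativeRel E
  ext x
  change ‖((x : E) : PadicAlgCl p)‖ ≤ 1 ↔ valuation E (x : E) ≤ 1
  rw [← Valuation.mem_integer_iff, PadicAlgCl.mem_integer_subfield_iff]
  rfl

variable [MeasurableSpace E] [BorelSpace E]

/-- **(i) at the model, canonically**: `Im(𝒪_E^▷ ↪ G_E^ab)` of `MonoAnalyticNonarch.ofPadicSubfield E` —
defined through a CHOSEN reciprocity map — is the set of classes of the non-negative Frobenius powers of
`G_E` (so it does not depend on that choice). [cite: MochizukiAbsTopIII2015, Prop 5.8 (i) p. 139] -/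
theorem MonoAnalyticNonarch.coe_ofPadicSubfield_integralImage :
    letI := PadicAlgCl.subfieldValuativeRel E
    haveI := PadicAlgCl.isNonarchimedeanLocalField_subfield E
    ((MonoAnalyticNonarch.ofPadicSubfield E).integralImage : Set (absoluteGaloisGroupAbelianization E)) =
      {a | ∃ σ : absoluteGaloisGroup E, (∃ n : ℕ, IsFrobPow σ n) ∧ absGaloisAbProj E σ = a} := by
  letI := PadicAlgCl.subfieldValuativeRel E; haveI := PadicAlgCl.isNonarchimedeanLocalField_subfield E
  rw [MonoAnalyticNonarch.ofPadicSubfield_integralImage, Submonoid.coe_map,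
    PadicAlgCl.coe_subfieldIntegralUnits]
  exact (PadicAlgCl.isLocalReciprocityMap_subfieldRecMap E).image_integers_eq_frobPow

end Subfield

namespace MonoAnalyticNonarchAlgorithm

/-- **Prop 5.8 (i), PRESENTATION-INDEPENDENCE of `Im(𝒪_k^▷ ↪ G^ab)`**: for EVERY presentation
`P : G ≅ G_E` of a profinite group `G` of MLF-Galois type (not only the one chosen by `model`), an
element `a ∈ G^ab` lies in the reconstructed `Im(𝒪_k^▷)` of `model.out G` iff its image in `G_E^ab` is
the class of a non-negative Frobenius power of `G_E`.  Hence this output is an invariant of the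
topological group `G` ("group-theoretic"), independent of the presenting field and of the reciprocity
map. [cite: MochizukiAbsTopIII2015, Prop 5.8 (i) p. 139] -/
theorem mem_model_out_integralImage_iff (G : ProfiniteGrp.{0}) (hG : IsMLFGaloisType G)
    (P : Presentation G) (a : profiniteAbelianization G) :
    haveI := P.prime; haveI := P.finite
    letI := PadicAlgCl.subfieldValuativeRel P.E
    haveI := PadicAlgCl.isNonarchimedeanLocalField_subfield P.E
    a ∈ (model.out G hG).integralImage ↔
      ∃ σ : absoluteGaloisGroup P.E, (∃ n : ℕ, IsFrobPow σ n) ∧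
        absGaloisAbProj P.E σ =
          profiniteAbelianizationCongr (G := G) (H := absoluteGaloisGrp P.E) P.iso a := by
  haveI := P.prime; haveI := P.finite
  letI := PadicAlgCl.subfieldValuativeRel P.E; haveI := PadicAlgCl.isNonarchimedeanLocalField_subfield P.E
  haveI := (presentation G hG).prime; haveI := (presentation G hG).finite
  letI := PadicAlgCl.subfieldValuativeRel (presentation G hG).E
  haveI := PadicAlgCl.isNonarchimedeanLocalField_subfield (presentation G hG).E
  letI : MeasurableSpace (presentation G hG).E := borel _; haveI : BorelSpace (presentation G hG).E := ⟨rfl⟩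
  let α : absoluteGaloisGroup (presentation G hG).E ≃ₜ* absoluteGaloisGroup P.E :=
    (presentation G hG).iso.symm.trans P.iso
  have hmem : a ∈ (model.out G hG).integralImage ↔
      profiniteAbelianizationCongr (G := G) (H := absoluteGaloisGrp (presentation G hG).E)
          (presentation G hG).iso a ∈
        ((MonoAnalyticNonarch.ofPadicSubfield (presentation G hG).E).integralImage :
          Set (absoluteGaloisGroupAbelianization (presentation G hG).E)) := Iff.rfl
  rw [hmem, MonoAnalyticNonarch.coe_ofPadicSubfield_integralImage]
  have hcongr : profiniteAbelianizationCongr (G := G) (H := absoluteGaloisGrp P.E) P.iso a =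
      profiniteAbelianizationCongr (G := absoluteGaloisGrp (presentation G hG).E)
        (H := absoluteGaloisGrp P.E) α
        (profiniteAbelianizationCongr (G := G) (H := absoluteGaloisGrp (presentation G hG).E)
          (presentation G hG).iso a) := by
    induction a using QuotientGroup.induction_on with
    | H g =>
      simp only [profiniteAbelianizationCongr_mk]
      congr 1
      show P.iso g = P.iso ((presentation G hG).iso.symm ((presentation G hG).iso g))
      rw [ContinuousMulEquiv.symm_apply_apply]
  constructor
  · rintro ⟨σ, ⟨n, hσn⟩, hσ⟩
    refine ⟨α σ, ⟨n, isFrobPow_map_natCast_of_continuousMulEquiv α hσn⟩, ?_⟩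
    rw [hcongr, ← hσ]
    rfl
  · rintro ⟨σ, ⟨n, hσn⟩, hσ⟩
    refine ⟨α.symm σ, ⟨n, isFrobPow_map_natCast_of_continuousMulEquiv α.symm hσn⟩, ?_⟩
    apply (profiniteAbelianizationCongr (G := absoluteGaloisGrp (presentation G hG).E)
      (H := absoluteGaloisGrp P.E) α).injective
    rw [← hcongr, ← hσ]
    change QuotientGroup.mk (α (α.symm σ)) = QuotientGroup.mk σ
    rw [ContinuousMulEquiv.apply_symm_apply]

/-- **Prop 5.8 (i), PRESENTATION-INDEPENDENCE of `Im(k^× ↪ G^ab)`**: for EVERY presentation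
`P : G ≅ G_E`, `a ∈ Im(k^×)` of `model.out G` iff its image in `G_E^ab` is the class of an element of
the Weil group `W_E`. [cite: MochizukiAbsTopIII2015, Prop 5.8 (i) p. 139] -/
theorem mem_model_out_multImage_iff (G : ProfiniteGrp.{0}) (hG : IsMLFGaloisType G)
    (P : Presentation G) (a : profiniteAbelianization G) :
    haveI := P.prime; haveI := P.finite
    letI := PadicAlgCl.subfieldValuativeRel P.E
    haveI := PadicAlgCl.isNonarchimedeanLocalField_subfield P.E
    a ∈ (model.out G hG).multImage ↔
      ∃ σ ∈ weilSubgroup P.E,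
        absGaloisAbProj P.E σ =
          profiniteAbelianizationCongr (G := G) (H := absoluteGaloisGrp P.E) P.iso a := by
  haveI := P.prime; haveI := P.finite
  letI := PadicAlgCl.subfieldValuativeRel P.E; haveI := PadicAlgCl.isNonarchimedeanLocalField_subfield P.E
  haveI := (presentation G hG).prime; haveI := (presentation G hG).finite
  letI := PadicAlgCl.subfieldValuativeRel (presentation G hG).E
  haveI := PadicAlgCl.isNonarchimedeanLocalField_subfield (presentation G hG).E
  letI : MeasurableSpace (presentation G hG).E := borel _; haveI : BorelSpace (presentation G hG).E := ⟨rfl⟩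
  let α : absoluteGaloisGroup (presentation G hG).E ≃ₜ* absoluteGaloisGroup P.E :=
    (presentation G hG).iso.symm.trans P.iso
  have hmem : a ∈ (model.out G hG).multImage ↔
      profiniteAbelianizationCongr (G := G) (H := absoluteGaloisGrp (presentation G hG).E)
          (presentation G hG).iso a ∈
        (MonoAnalyticNonarch.ofPadicSubfield (presentation G hG).E).multImage := Iff.rfl
  rw [hmem, MonoAnalyticNonarch.ofPadicSubfield_multImage, Subgroup.mem_map]
  have hcongr : profiniteAbelianizationCongr (G := G) (H := absoluteGaloisGrp P.E) P.iso a =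
      profiniteAbelianizationCongr (G := absoluteGaloisGrp (presentation G hG).E)
        (H := absoluteGaloisGrp P.E) α
        (profiniteAbelianizationCongr (G := G) (H := absoluteGaloisGrp (presentation G hG).E)
          (presentation G hG).iso a) := by
    induction a using QuotientGroup.induction_on with
    | H g =>
      simp only [profiniteAbelianizationCongr_mk]
      congr 1
      show P.iso g = P.iso ((presentation G hG).iso.symm ((presentation G hG).iso g))
      rw [ContinuousMulEquiv.symm_apply_apply]
  have hW := map_weilSubgroup_eq_of_continuousMulEquiv α
  constructor
  · rintro ⟨σ, hσW, hσ⟩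
    refine ⟨α σ, ?_, ?_⟩
    · rw [← hW]; exact ⟨σ, hσW, rfl⟩
    · rw [hcongr, ← hσ]; rfl
  · rintro ⟨σ, hσW, hσ⟩
    rw [← hW] at hσW
    obtain ⟨τ, hτW, rfl⟩ := hσW
    refine ⟨τ, hτW, ?_⟩
    apply (profiniteAbelianizationCongr (G := absoluteGaloisGrp (presentation G hG).E)
      (H := absoluteGaloisGrp P.E) α).injective
    rw [← hcongr, ← hσ]
    rfl

/-- **Functoriality for isomorphisms of `Ob(TG⊢)`, `Im(𝒪^▷)`**: for `e : G ≅ H` of MLF-Galois-type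
groups, `a ∈ Im(𝒪_k^▷)(G) ↔ e^ab(a) ∈ Im(𝒪_k^▷)(H)` — the induced `G^ab ⥲ H^ab` identifies the
reconstructed images (apply the presentation-independence to `H`'s chosen presentation and to its
pull-back along `e`). [cite: MochizukiAbsTopIII2015, Prop 5.8 (i) p. 139] -/
theorem mem_model_out_integralImage_iff_of_iso {G H : ProfiniteGrp.{0}} (hG : IsMLFGaloisType G)
    (hH : IsMLFGaloisType H) (e : G ≃ₜ* H) (a : profiniteAbelianization G) :
    a ∈ (model.out G hG).integralImage ↔
      profiniteAbelianizationCongr e a ∈ (model.out H hH).integralImage := by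
  haveI := (presentation H hH).prime; haveI := (presentation H hH).finite
  let P' : Presentation G :=
    { p := (presentation H hH).p, E := (presentation H hH).E, iso := e.trans (presentation H hH).iso }
  rw [mem_model_out_integralImage_iff G hG P' a,
    mem_model_out_integralImage_iff H hH (presentation H hH) (profiniteAbelianizationCongr e a),
    ← profiniteAbelianizationCongr_trans_apply]

/-- **Functoriality for isomorphisms of `Ob(TG⊢)`, `Im(k^×)`**: `a ∈ Im(k^×)(G) ↔ e^ab(a) ∈ Im(k^×)(H)`.
[cite: MochizukiAbsTopIII2015, Prop 5.8 (i) p. 139] -/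
theorem mem_model_out_multImage_iff_of_iso {G H : ProfiniteGrp.{0}} (hG : IsMLFGaloisType G)
    (hH : IsMLFGaloisType H) (e : G ≃ₜ* H) (a : profiniteAbelianization G) :
    a ∈ (model.out G hG).multImage ↔
      profiniteAbelianizationCongr e a ∈ (model.out H hH).multImage := by
  haveI := (presentation H hH).prime; haveI := (presentation H hH).finite
  let P' : Presentation G :=
    { p := (presentation H hH).p, E := (presentation H hH).E, iso := e.trans (presentation H hH).iso }
  rw [mem_model_out_multImage_iff G hG P' a,
    mem_model_out_multImage_iff H hH (presentation H hH) (profiniteAbelianizationCongr e a),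
    ← profiniteAbelianizationCongr_trans_apply]

end MonoAnalyticNonarchAlgorithm

end Literature.AnabelianGeometry.AbsoluteAnabelian

end
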